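import Summits.CriticalPhenomena.PercolationContinuityZ3.Theorems.PercNearOneGluingNoHeavyPcintThirdMemFuture
import HarnessLib

/-!
# PCINT lane, reduction B3t on the memory-`τ` DANGEROUS-SET automaton — per-word domination and the glue

Cell `prim-pcint` (PAPER-2 track (iii): certified intervals for `p_c(ℤ^d)`), seat `prim-pcint-2` (gen 4); support file
(`--supports stmt-CriticalPhenomena-4575`).  Does NOT build on p205010.  Memo: `run/shared/lean/prim/pcint/REDUCTIONS.md` §B3t.

For a self-avoiding word `γ` of length `n` the full B3t weight `thirdBondWeight p s t kc γ` (`…ThirdBondUnits`,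
`θ ≤ Σ thirdBondWeight` in `…ThirdBondReduction`) is at most the run weight of the dangerous-set B3t automaton
`bthirdMemAut τ kc p (1-p) s t κ̄` of `…ThirdMem` from the empty state (`thirdBondWeight_le_run`): off the path the time
factors are dominated step by step (`tgapFactor_le_offF`); on the path, the charges at a future vertex `v_h` together with the
chord factor `tchordF` of the step creating `v_h` and the charges `≥ s t` at forgotten vertices dominate `(1-p)^{#chords}`
upper endpoint by upper endpoint (`chord_booking_ineq` with `prod_chargeF_future_ge`, `card_chordPairs_fiber`; constants
`1 - p ≤ s t²`, `t ≤ s²`).  Summing over `SAW_n`: `Σ thirdBondWeight ≤ total n ∅` and the glue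
**`le_criticalProb_zd_of_thirdMem_total`**.
-/

noncomputable section

namespace Summit.CriticalPhenomena.PercolationContinuityZ3.Theorems.Pcint

open Finset Literature.Probability.Percolation Literature.Probability.LatticeModels ChainBond

variable {d : ℕ} (a₀ : Fin d × Bool) {τ kc n : ℕ} {γ : Fin n → Fin d × Bool}

/-- The undetected chords counted by upper endpoint. [folklore] -/
theorem card_invChordsR_eq_sum (τ : ℕ) (γ : Fin n → Fin d × Bool) :
    (invChordsR τ γ).card = ∑ t ∈ range n, ((invChordsR τ γ).filter fun ij => ij.2 = t + 1).card := by
  classical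
  rw [card_eq_sum_card_fiberwise (f := fun ij : ℕ × ℕ => ij.2 - 1) (t := range n) (fun ij hij => ?_)]
  · refine sum_congr rfl fun t ht => ?_
    congr 1
    ext ij
    simp only [mem_filter, and_congr_right_iff]
    intro hij
    have := (mem_chordPairs.1 (mem_filter.1 hij).1).1
    omega
  · have h1 := (mem_chordPairs.1 (mem_filter.1 hij).1).1
    have h2 := (mem_chordPairs.1 (mem_filter.1 hij).1).2.1
    rw [mem_coe, mem_range]; show ij.2 - 1 < n; omega

/-- The chord pairs counted by upper endpoint. [folklore] -/
theorem card_chordPairs_eq_sum (γ : Fin n → Fin d × Bool) :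
    (chordPairs γ).card = ∑ t ∈ range n, ((chordPairs γ).filter fun ij => ij.2 = t + 1).card := by
  classical
  rw [card_eq_sum_card_fiberwise (f := fun ij : ℕ × ℕ => ij.2 - 1) (t := range n) (fun ij hij => ?_)]
  · refine sum_congr rfl fun t ht => ?_
    congr 1
    ext ij
    simp only [mem_filter, and_congr_right_iff]
    intro hij
    have := (mem_chordPairs.1 hij).1
    omega
  · have h1 := (mem_chordPairs.1 hij).1
    have h2 := (mem_chordPairs.1 hij).2.1
    rw [mem_coe, mem_range]; show ij.2 - 1 < n; omega

/-- The detected and undetected chords with upper endpoint `t + 1` number `kp (t+1)`. [folklore] -/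
theorem card_vis_add_inv_fiber {t : ℕ} (ht : t < n) :
    remChordTrue τ γ t + ((invChordsR τ γ).filter fun ij => ij.2 = t + 1).card = kp γ (t + 1) := by
  classical
  rw [remChordTrue_eq_card γ ht, ← card_chordPairs_fiber (γ := γ) (by omega) (by omega), visChordsR, invChordsR,
    filter_filter, filter_filter, ← card_union_of_disjoint, ← filter_or]
  · congr 1; ext ij; simp only [mem_filter]; tauto
  · rw [disjoint_left]; intro ij h1 h2; exact (mem_filter.1 h2).2.1 (mem_filter.1 h1).2.1

include a₀ in
/-- **Per-word domination (B3t)**: for a self-avoiding word, the B3t weight is at most the run weight of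
`bthirdMemAut τ kc p (1-p) s t κ̄` from the empty dangerous set, whenever `0 < t ≤ s ≤ 1`, `(1+s²)/2 ≤ κ̄`, `1 - p ≤ s t²`,
`t ≤ s²`, `kc ≥ 2`, `kc + 4 ≤ τ`. [folklore] -/
theorem thirdBondWeight_le_run (hτ : kc + 4 ≤ τ) (hkc : 2 ≤ kc) (hsaw : IsSAW γ) (p : unitInterval) {s tv κb : ℝ}
    (hs0 : 0 < s) (hs1 : s ≤ 1) (ht0 : 0 < tv) (hts : tv ≤ s) (hκb : (1 + s ^ 2) / 2 ≤ κb)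
    (hqt : 1 - (p : ℝ) ≤ s * tv ^ 2) (hts2 : tv ≤ s ^ 2) :
    thirdBondWeight p s tv kc γ ≤
      (bthirdMemAut τ kc p (1 - p) s tv κb p.2.1 (sub_nonneg.2 p.2.2) hs0.le ht0.le (by nlinarith)).run n ∅ γ := by
  classical
  have hp0 : (0 : ℝ) ≤ p := p.2.1
  have hq0 : 0 ≤ 1 - (p : ℝ) := sub_nonneg.2 p.2.2
  have hκb0 : 0 ≤ κb := by nlinarith
  have hss : s ^ 2 ≤ κb := by nlinarith
  have hτ2 : 2 ≤ τ := by omega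
  have ht1 : tv ≤ 1 := hts.trans hs1
  have hq_t : 1 - (p : ℝ) ≤ tv := hqt.trans (by nlinarith [mul_le_mul ht1 ht1 ht0.le zero_le_one, hs1])
  have hq_s2 : 1 - (p : ℝ) ≤ s ^ 2 := hq_t.trans hts2
  set q1 : ℝ := 1 - (p : ℝ) with hq1
  set M := bthirdMemAut (d := d) τ kc p q1 s tv κb hp0 hq0 hs0.le ht0.le hκb0 with hM
  -- the run follows the dangerous sets
  have hrun := M.run_eq_prod_of_states n (fun t => danger τ (pre a₀ γ t)) γ (fun t ht => by
    rw [hM]; exact mstep_danger_pre a₀ hτ2 hsaw ht)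
  rw [danger_zero τ _] at hrun
  rw [hrun, thirdBondWeight_eq_prod, prod_range_succ' _ n, tgapFactor_zero, mul_one]
  -- the weights, split as chord factor × off × on
  set S := fun t => danger τ (pre a₀ γ t) with hS
  have hwt : ∀ (t : ℕ) (ht : t < n), M.wt (S t) (γ ⟨t, ht⟩) =
      (p : ℝ) * (tchordF q1 s tv (bchord (S t) (γ ⟨t, ht⟩)) * (offF a₀ s tv κb τ kc γ t * onF a₀ s tv κb τ kc γ t)) := by
    intro t ht
    rw [hM, ← unitFactor_eq_offF_mul_onF a₀ ht]
    show (p : ℝ) * btwt q1 s tv κb τ kc (S t) (γ ⟨t, ht⟩) = _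
    rw [btwt, mul_assoc (s ^ _)]
  set A := ∏ t ∈ range n, (if ht : t < n then tchordF q1 s tv (bchord (S t) (γ ⟨t, ht⟩)) else 1) with hA
  set OFF := ∏ t ∈ range n, offF a₀ s tv κb τ kc γ t with hOFF
  set ON := ∏ t ∈ range n, onF a₀ s tv κb τ kc γ t with hON
  have hA0 : 0 ≤ A := prod_nonneg fun t _ => by split_ifs; exact tchordF_nonneg hq0 hs0.le ht0.le _; exact zero_le_one
  have hON0 : 0 ≤ ON := prod_nonneg fun t _ => onF_nonneg a₀ hs0.le ht0.le hκb0 t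
  have hOFF0 : 0 ≤ OFF := prod_nonneg fun t _ => offF_nonneg a₀ hs0.le ht0.le hκb0 t
  have hprod : (∏ t ∈ range n, if ht : t < n then M.wt (S t) (γ ⟨t, ht⟩) else 1) = (p : ℝ) ^ n * (A * ON * OFF) := by
    have hpn : (p : ℝ) ^ n = ∏ _t ∈ range n, (p : ℝ) := by rw [prod_const, card_range]
    rw [hpn, hA, hON, hOFF, ← prod_mul_distrib, ← prod_mul_distrib, ← prod_mul_distrib]
    refine prod_congr rfl fun t ht => ?_
    have ht' := mem_range.1 ht
    rw [dif_pos ht', dif_pos ht', hwt t ht']; ring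
  -- (1) off the path
  have hoff : ∏ t ∈ range n, tgapFactor s tv kc γ (t + 1) ≤ OFF :=
    prod_le_prod (fun t _ => tgapFactor_nonneg hs0.le ht0.le kc γ _) fun t ht =>
      tgapFactor_le_offF a₀ hτ hkc (mem_range.1 ht) hs0.le hs1 ht0.le hts hκb
  -- (2) on the path: events, split by type, and the chord factors
  set E := onEventsR τ γ with hE
  set ch : ℕ × ℕ → ℝ := fun th => chargeF a₀ s tv τ kc γ th.1 (wordPos γ th.2) with hch
  have hch0 : ∀ th, 0 ≤ ch th := fun th => chargeF_nonneg a₀ hs0.le ht0.le _ _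
  have hch1 : ∀ th, ch th ≤ 1 := fun th => chargeF_le_one a₀ hs0.le hs1 ht0.le hts _ _
  have hON_E : ∏ th ∈ E, ch th ≤ ON := by
    rw [← prod_fiberwise_of_maps_to (s := E) (t := range n) (g := Prod.fst) fun th hth => mem_range.2 (mem_onEventsR.1 hth).1]
    refine prod_le_prod (fun t _ => prod_nonneg fun th _ => hch0 th) fun t ht => ?_
    have := prod_chargeF_le_onF a₀ (γ := γ) (κb := κb) (kc := kc) hτ2 (mem_range.1 ht) hs0.le hs1 ht0.le hts hss
    refine le_trans (le_of_eq (prod_congr rfl fun th hth => ?_)) this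
    have h1 : th.1 = t := (mem_filter.1 hth).2
    simp only [hch, h1]
  set T1 := E.filter fun th => th.1 + 1 < th.2 with hT1
  set T2 := E.filter fun th => th.2 < th.1 with hT2
  have hsplitE : ∏ th ∈ E, ch th = (∏ th ∈ T1, ch th) * ∏ th ∈ T2, ch th := by
    rw [hT1, hT2, ← prod_filter_mul_prod_filter_not E (fun th => th.1 + 1 < th.2)]
    congr 1
    refine prod_congr ?_ fun _ _ => rfl
    ext th
    simp only [mem_filter, and_congr_right_iff]
    intro hth
    obtain ⟨-, -, hne, hne1, -⟩ := mem_onEventsR.1 hth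
    omega
  -- type 1: future vertices
  have hT1ge : ∏ t ∈ range n, (if 1 ≤ kp γ (t + 1) then s ^ 2 * tv ^ (kp γ (t + 1) - 1) else 1) ≤ ∏ th ∈ T1, ch th := by
    have hfib : ∀ h, T1.filter (fun th => th.2 = h) = futureEv τ γ h := by
      intro h; ext th
      simp only [hT1, futureEv, mem_filter, and_assoc]
      constructor
      · rintro ⟨hm, hlt, rfl⟩; exact ⟨hm, rfl, hlt⟩
      · rintro ⟨hm, rfl, hlt⟩; exact ⟨hm, hlt, rfl⟩
    rw [← prod_fiberwise_of_maps_to (s := T1) (t := range (n + 1)) (g := Prod.snd) fun th hth =>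
      mem_range.2 (Nat.lt_succ_of_le (mem_onEventsR.1 (mem_filter.1 hth).1).2.1), prod_range_succ' _ n]
    have h0 : ∏ th ∈ T1.filter (fun th => th.2 = 0), ch th = 1 := by
      rw [hfib 0, futureEv]
      refine prod_eq_one fun th hth => ?_
      have := (mem_filter.1 hth).2.2; omega
    rw [h0, mul_one]
    refine prod_le_prod (fun t _ => by split_ifs <;> positivity) fun t ht => ?_
    rw [hfib (t + 1), prod_congr rfl (fun th hth => show ch th = chargeF a₀ s tv τ kc γ th.1 (wordPos γ (t + 1)) by
      have h2 : th.2 = t + 1 := (mem_filter.1 hth).2.1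
      simp only [hch, h2])]
    exact prod_chargeF_future_ge a₀ hτ hkc hs0.le hs1 ht0.le hts (by have := mem_range.1 ht; omega)
  -- type 2: forgotten vertices, injected into the undetected chords
  have hT2card : T2.card ≤ (invChordsR τ γ).card := by
    refine card_le_card_of_injOn (bookR γ) (fun th hth => ?_) fun th hth th' hth' e => ?_
    · obtain ⟨hm, hlt⟩ := mem_filter.1 (mem_coe.1 hth)
      exact mem_coe.2 ((bookR_mem hm).2 hlt)
    · exact bookR_inj_before (mem_filter.1 (mem_coe.1 hth)).2 (mem_filter.1 (mem_coe.1 hth')).2 e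
  have hst0 : 0 ≤ s * tv := mul_nonneg hs0.le ht0.le
  have hst1 : s * tv ≤ 1 := mul_le_one₀ hs1 ht0.le ht1
  have hT2ge : (s * tv) ^ (invChordsR τ γ).card ≤ ∏ th ∈ T2, ch th :=
    calc (s * tv) ^ (invChordsR τ γ).card ≤ (s * tv) ^ T2.card := pow_le_pow_of_le_one hst0 hst1 hT2card
      _ = ∏ _th ∈ T2, (s * tv) := by rw [prod_const]
      _ ≤ ∏ th ∈ T2, ch th := prod_le_prod (fun _ _ => hst0) fun th _ => chargeF_ge_st a₀ hs0.le hs1 ht0.le hts _ _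
  -- the chord factors, antitone in the detected chord count
  have hA' : ∏ t ∈ range n, tchordF q1 s tv (remChordTrue τ γ t) ≤ A := by
    refine prod_le_prod (fun t _ => tchordF_nonneg hq0 hs0.le ht0.le _) fun t ht => ?_
    rw [dif_pos (mem_range.1 ht)]
    exact tchordF_anti hq0 hq_t hq_s2 hs0 ht0 (bchord_le_remChordTrue a₀ (mem_range.1 ht))
  -- the booking, upper endpoint by upper endpoint
  have hbook : q1 ^ (chordEdges γ).card ≤
      (∏ t ∈ range n, tchordF q1 s tv (remChordTrue τ γ t)) *
        (∏ t ∈ range n, (if 1 ≤ kp γ (t + 1) then s ^ 2 * tv ^ (kp γ (t + 1) - 1) else 1)) *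
        (s * tv) ^ (invChordsR τ γ).card := by
    rw [← IsSAW.card_chordPairs_eq hsaw, card_chordPairs_eq_sum, card_invChordsR_eq_sum, ← prod_pow_eq_pow_sum,
      ← prod_pow_eq_pow_sum, ← prod_mul_distrib, ← prod_mul_distrib]
    refine prod_le_prod (fun t _ => pow_nonneg hq0 _) fun t ht => ?_
    have ht' := mem_range.1 ht
    have hk := card_vis_add_inv_fiber (τ := τ) (γ := γ) ht'
    rw [card_chordPairs_fiber (γ := γ) (by omega) (by omega), ← hk]
    exact chord_booking_ineq hq0 hs0 ht0 hqt hts2 _ _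
  -- assembly
  set Pk := ∏ t ∈ range n, tgapFactor s tv kc γ (t + 1) with hPk
  have hPk0 : 0 ≤ Pk := prod_nonneg fun t _ => tgapFactor_nonneg hs0.le ht0.le kc γ _
  have hchords : q1 ^ (chordEdges γ).card ≤ A * ON := by
    refine hbook.trans ?_
    have h1 : (∏ t ∈ range n, (if 1 ≤ kp γ (t + 1) then s ^ 2 * tv ^ (kp γ (t + 1) - 1) else 1)) *
        (s * tv) ^ (invChordsR τ γ).card ≤ ON := by
      calc _ ≤ (∏ th ∈ T1, ch th) * ∏ th ∈ T2, ch th :=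
            mul_le_mul hT1ge hT2ge (pow_nonneg hst0 _) (prod_nonneg fun th _ => hch0 th)
        _ = ∏ th ∈ E, ch th := hsplitE.symm
        _ ≤ ON := hON_E
    have h10 : 0 ≤ (∏ t ∈ range n, (if 1 ≤ kp γ (t + 1) then s ^ 2 * tv ^ (kp γ (t + 1) - 1) else 1)) *
        (s * tv) ^ (invChordsR τ γ).card :=
      mul_nonneg (prod_nonneg fun t _ => by split_ifs <;> positivity) (pow_nonneg hst0 _)
    rw [mul_assoc]
    exact mul_le_mul hA' h1 h10 hA0
  rw [hprod]
  calc (p : ℝ) ^ n * q1 ^ (chordEdges γ).card * Pk = (p : ℝ) ^ n * (q1 ^ (chordEdges γ).card * Pk) := by ring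
    _ ≤ (p : ℝ) ^ n * (A * ON * OFF) :=
        mul_le_mul_of_nonneg_left (mul_le_mul hchords hoff hPk0 (mul_nonneg hA0 hON0)) (pow_nonneg hp0 _)

include a₀ in
/-- **Sum form**: `Σ_{γ ∈ SAW_n} thirdBondWeight p s t kc γ ≤ total n ∅` for the dangerous-set B3t automaton. [folklore] -/
theorem sum_thirdBondWeight_le_total (hτ : kc + 4 ≤ τ) (hkc : 2 ≤ kc) (p : unitInterval) {s tv κb : ℝ}
    (hs0 : 0 < s) (hs1 : s ≤ 1) (ht0 : 0 < tv) (hts : tv ≤ s) (hκb : (1 + s ^ 2) / 2 ≤ κb)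
    (hqt : 1 - (p : ℝ) ≤ s * tv ^ 2) (hts2 : tv ≤ s ^ 2) (n : ℕ) :
    ∑ γ ∈ sawWords d n, thirdBondWeight p s tv kc γ ≤
      (bthirdMemAut τ kc p (1 - p) s tv κb p.2.1 (sub_nonneg.2 p.2.2) hs0.le ht0.le (by nlinarith)).total n
        (∅ : MState d) := by
  classical
  set M := bthirdMemAut (d := d) τ kc p (1 - p) s tv κb p.2.1 (sub_nonneg.2 p.2.2) hs0.le ht0.le (by nlinarith) with hM
  calc ∑ γ ∈ sawWords d n, thirdBondWeight p s tv kc γ ≤ ∑ γ ∈ sawWords d n, M.run n ∅ γ :=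
        sum_le_sum fun γ hγ => by
          rw [hM]; exact thirdBondWeight_le_run a₀ hτ hkc (mem_sawWords.1 hγ) p hs0 hs1 ht0 hts hκb hqt hts2
    _ ≤ M.total n ∅ := M.sum_run_le_total n ∅ _

/-- **Reduced-state B3t certificate ⇒ `p ≤ p_c^bond(ℤ^d)`.**  If the totals of the dangerous-set B3t automaton from the
empty state are geometrically small, `total n ∅ ≤ C λⁿ` with `λ < 1`, for constants with `1 - p² ≤ s²`, `0 < t ≤ s ≤ 1`,
`(1-p)(1+2p) ≤ t(1+p)`, `p²(1-p) ≤ s²(s-t)`, `1 - p ≤ s t²`, `t ≤ s²`, `(1+s²)/2 ≤ κ̄`, `kc ≥ 2`, `kc + 4 ≤ τ`, then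
`p ≤ p_c^bond(ℤ^d)`. [folklore] -/
theorem le_criticalProb_zd_of_thirdMem_total [NeZero d] {τ kc : ℕ} (hτ : kc + 4 ≤ τ) (hkc : 2 ≤ kc) (p : unitInterval)
    {s tv κb C lam : ℝ} (hps : 1 - (p : ℝ) ^ 2 ≤ s ^ 2) (hs0 : 0 < s) (hs1 : s ≤ 1) (ht0 : 0 < tv) (hts : tv ≤ s)
    (htp : (1 - (p : ℝ)) * (1 + 2 * p) ≤ tv * (1 + p)) (hst : (p : ℝ) ^ 2 * (1 - p) ≤ s ^ 2 * (s - tv))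
    (hqt : 1 - (p : ℝ) ≤ s * tv ^ 2) (hts2 : tv ≤ s ^ 2) (hκb : (1 + s ^ 2) / 2 ≤ κb) (hlam0 : 0 ≤ lam) (hlam1 : lam < 1)
    (htot : ∀ n, (bthirdMemAut τ kc p (1 - p) s tv κb p.2.1 (sub_nonneg.2 p.2.2) hs0.le ht0.le (by nlinarith)).total n
      (∅ : MState d) ≤ C * lam ^ n) :
    (p : ℝ) ≤ criticalProb (zdGraph d) 0 :=
  le_criticalProb_zd_of_thirdBond_le_geometric d p hps hs1 ht0.le hts htp hst hkc hlam0 hlam1 (C := C) fun n =>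
    (sum_thirdBondWeight_le_total ((⟨0, NeZero.pos d⟩, true) : Fin d × Bool) hτ hkc p hs0 hs1 ht0 hts hκb hqt hts2
      n).trans (htot n)

end Summit.CriticalPhenomena.PercolationContinuityZ3.Theorems.Pcint
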